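import Summits.BirchSwinnertonDyer.Rank1Residual.GaloisImage.HauptmodulDeltaQuarticValuation
import Summits.BirchSwinnertonDyer.Rank1Residual.GaloisImage.HauptmodulNineValuationThree
import Summits.BirchSwinnertonDyer.Rank1Residual.GaloisImage.HauptmodulNineValuationFour
import HarnessLib

/-!
# The level-`9` Hauptmodul at `v₃(j) = 3k + 3 ≥ 6`, `j/3^{v₃(j)} ≡ −2w₀ (mod 9)` (`w₀ = ±1`) is
# VALUATION-FORCED: `v((2((θ³ − 24)/3^{k+1} − w₀)/θ)² − 1)⁹ = v(3)`
# (cell `b2b-bsdres`, team n1011, seat p02 gen 5 — row T-b11-F4, file F4c-H13 'Hauptmodul route,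
# curve-free core at v₃(j) ≡ 0 (mod 3), v₃(j) ≥ 6, part 2'; pure valuation algebra in `ℚ̄`)

HONEST FRAMING (cell `b2b-bsdres`, run/shared/lean/b2b/bsd-rank1-residual/, verbatim in every
file): the goal of the cell is to DELETE the COMBINATION-SHAPED residual classes of the
Birch–Swinnerton-Dyer formula for ALL analytic-rank `≤ 1` elliptic curves over `ℚ` — "full BSD
formula for every rank `≤ 1` curve in class `C`" assembled STRICTLY from published theorems — so
that the rank-`≤ 1` remainder becomes exactly the CONSTRUCTION-SHAPED classes, which are TYPED
(missing-input `Prop`s), NOT attempted. This is not "finishing BSD". Team n1011 (N10 / N11):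
research route; no claim beyond the stated classes; labels UNCHANGED; nothing is booked. Theorems
only (no definition, no named fact).

## What this file proves

`v` the place of `ℚ̄` over `3`, `t = v(3)`.

* **`valuation_hauptmodul_nine_invariant_vzero_pow_nine`** — `k ≥ 1`, `w₀ = ±1`, `j ∈ ℚ` with
  `9 ∣ num(j/3^{3k+3} + 2w₀)` (so `v₃(j) = 3k + 3` and `j/3^{v₃(j)} ≡ −2w₀ (mod 9)`), `S, θ ∈ ℚ̄`
  with `j(S − 27) = S(S − 24)³`, `v(S) = t`, `θ³ = S` ⟹
  **`v((2((θ³ − 24)/3^{k+1} − w₀)/θ)² − 1)⁹ = t`**.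
  Proof: `S = 3(3^k w + 8)`; `HauptmodulDeltaQuarticValuation` gives `v(w) = 1`, `v(w − w₀)³ = t`
  and `v(N) = t·v(w − w₀)` for `N = −8w₀(w − w₀)³ − 3(3^k w + 8)`; with `Y = 2(w − w₀)/θ`,
  `X = −w₀Y`: `(X³ − 1)θ³ = N`, so `v(X³ − 1)³ = t`, the cube-root lemma
  (`HauptmodulNineValuationFour.valuation_sub_one_pow_nine_of_cube`) gives `v(X − 1)⁹ = t`, and
  `Y² − 1 = (X − 1)(X + 1)` with `X + 1` a unit.

For `E/ℚ` in this class and a cyclic `C ⊂ E[9]` over a non-canonical `3`-torsion group,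
`θ = η(E, C) + 3` satisfies the hypotheses (`HauptmodulNineInvariant`,
`HauptmodulThreeShapeValuation`), so `z = (2((θ³ − 24)/3^{k+1} − w₀)/θ)² − 1 ∈ ℚ(C)` is a
`Stab(C)`-invariant with `v(z)⁹ = v(3)`: the scalar-stabiliser tower criterion gives the `3`-adic
tower from surj(3) on the family `v₃(j) ≡ 0 (mod 3)`, `v₃(j) ≥ 6`, `j/3^{v₃(j)} ≡ ±2 (mod 9)` of
the EXOTIC core (155 census cells; EVIDENCE kit j135556: `v(z) = 1/9` on 155/155, and the
complementary classes `j/3^{v₃(j)} ≡ ±1 (mod 9)` have no prime of `ℚ(θ)` over `3` with `9 ∣ ef`).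
Nothing booked.

References: [Maier2006] Table 4 (N = 3, 9), §5.
-/

noncomputable section

set_option maxRecDepth 10000

open scoped Classical

namespace Summit.BirchSwinnertonDyer.Rank1Residual.GaloisImage

open Literature.NumberTheory.EllipticCurves Literature.NumberTheory.GaloisRepresentations
  Rat.HeightOneSpectrum

/-- **The level-`9` Hauptmodul at `v₃(j) = 3k + 3 ≥ 6`, `j/3^{v₃(j)} ≡ −2w₀ (mod 9)` is
valuation-forced.**  Let `k ≥ 1`, `w₀ = ±1`, `j ∈ ℚ` with `9 ∣ num(j/3^{3k+3} + 2w₀)`, and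
`S, θ ∈ ℚ̄` with `j(S − 27) = S(S − 24)³`, `v(S) = v(3)` and `θ³ = S`.  Then
**`v((2((θ³ − 24)/3^{k+1} − w₀)/θ)² − 1)⁹ = v(3)`** — `3`-adic valuation exactly `1/9`.
[cite: Maier2006, Table 4 (N = 3, 9) and §5] -/
theorem valuation_hauptmodul_nine_invariant_vzero_pow_nine {j : ℚ} {k : ℕ} (hk : 1 ≤ k) {w₀ : ℤ}
    (hw₀ : w₀ = 1 ∨ w₀ = -1) (hj0 : (9 : ℤ) ∣ (j / 3 ^ (3 * k + 3) + 2 * w₀).num)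
    {S θ : AlgebraicClosure ℚ}
    (hS : algebraMap ℚ (AlgebraicClosure ℚ) j * (S - 27) = S * (S - 24) ^ 3)
    (hvS : (placeOver 3).valuation S = (placeOver 3).valuation (3 : AlgebraicClosure ℚ))
    (hθ : θ ^ 3 = S) :
    (placeOver 3).valuation
        ((2 * ((θ ^ 3 - 24) / 3 ^ (k + 1) - (w₀ : AlgebraicClosure ℚ)) / θ) ^ 2 - 1) ^ 9 =
      (placeOver 3).valuation (3 : AlgebraicClosure ℚ) := by
  set v := (placeOver 3).valuation with hv
  set t := v (3 : AlgebraicClosure ℚ) with ht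
  have ht1 : t < 1 := valuation_three_lt_one
  have ht0 : t ≠ 0 := valuation_three_ne_zero
  have h3 : (3 : AlgebraicClosure ℚ) ≠ 0 := by norm_num
  have hw₀' : (w₀ : AlgebraicClosure ℚ) = 1 ∨ (w₀ : AlgebraicClosure ℚ) = -1 := by
    rcases hw₀ with h | h
    · left; rw [h]; norm_num
    · right; rw [h]; norm_num
  have hsq : (w₀ : AlgebraicClosure ℚ) ^ 2 = 1 := by rcases hw₀' with h | h <;> rw [h] <;> norm_num
  have hvw₀ : v (w₀ : AlgebraicClosure ℚ) = 1 := by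
    rcases hw₀' with h | h
    · rw [h, map_one]
    · rw [h, Valuation.map_neg, map_one]
  -- `K = j/3^V ≡ −2w₀ (mod 9)`, a unit
  set K := algebraMap ℚ (AlgebraicClosure ℚ) (j / 3 ^ (3 * k + 3)) with hKdef
  have hK2 : v (K + 2 * w₀) ≤ t ^ 2 := by
    have e : K + 2 * (w₀ : AlgebraicClosure ℚ) =
        algebraMap ℚ (AlgebraicClosure ℚ) (j / 3 ^ (3 * k + 3) + 2 * w₀) := by
      rw [map_add, map_mul, map_ofNat, map_intCast]
    rw [e]
    exact valuation_algebraMap_le_sq_of_nine_dvd_num hj0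
  have hK : v K = 1 := by
    have h2 : v (2 * (w₀ : AlgebraicClosure ℚ)) = 1 := by
      rw [map_mul, hvw₀, mul_one]
      simpa using valuation_intCast_eq_one_of_not_dvd (n := 2) (by decide)
    have e : K = (K + 2 * w₀) - 2 * w₀ := by ring
    have hlt : v (K + 2 * (w₀ : AlgebraicClosure ℚ)) < v (2 * (w₀ : AlgebraicClosure ℚ)) := by
      rw [h2]; exact hK2.trans_lt (pow_lt_one₀ zero_le ht1 two_ne_zero)
    rw [e, valuation_sub_eq_of_lt' hlt, h2]
  have hjK : algebraMap ℚ (AlgebraicClosure ℚ) j = 3 ^ (3 * k + 3) * K := by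
    rw [hKdef, map_div₀, map_pow, map_ofNat, mul_div_cancel₀ _ (pow_ne_zero _ h3)]
  -- `S = 3(3^k w + 8)`
  obtain ⟨w, hSw⟩ : ∃ w : AlgebraicClosure ℚ, S = 3 * (3 ^ k * w + 8) :=
    ⟨(S / 3 - 8) / 3 ^ k, by field_simp; ring⟩
  subst hSw
  have hR : w ^ 3 * ((3 : AlgebraicClosure ℚ) ^ k * w + 8) = K * ((3 : AlgebraicClosure ℚ) ^ k * w - 1) := by
    rw [hjK] at hS
    have h0 : (3 : AlgebraicClosure ℚ) ^ (3 * k + 4) *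
        (w ^ 3 * ((3 : AlgebraicClosure ℚ) ^ k * w + 8) - K * ((3 : AlgebraicClosure ℚ) ^ k * w - 1)) = 0 := by
      linear_combination (-1 : AlgebraicClosure ℚ) * hS
    exact sub_eq_zero.mp ((mul_eq_zero.mp h0).resolve_left (pow_ne_zero _ h3))
  have h8 : v ((3 : AlgebraicClosure ℚ) ^ k * w + 8) = 1 := by
    have := hvS
    rw [map_mul] at this
    -- `t * v(P) = t`
    have e : t * v ((3 : AlgebraicClosure ℚ) ^ k * w + 8) = t * 1 := by rw [mul_one]; exact this
    exact mul_left_cancel₀ ht0 e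
  have hP0 : (3 : AlgebraicClosure ℚ) ^ k * w + 8 ≠ 0 :=
    (Valuation.ne_zero_iff _).mp (by rw [h8]; exact one_ne_zero)
  have hθ0 : θ ≠ 0 := by
    intro h0
    rw [h0, zero_pow three_ne_zero] at hθ
    exact mul_ne_zero h3 hP0 hθ.symm
  have hw := valuation_w_eq_one hk hK h8 hR
  have hcube := valuation_w_cube_sub_eq hk hw₀' hK2 hw h8 hR
  have hs := valuation_w_sub_pow_three_eq hw₀' hcube
  set s := v (w - (w₀ : AlgebraicClosure ℚ)) with hsdef
  have hN := valuation_numerator_of_delta_quartic hk hw₀' hK2 hw h8 hR hs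
  -- `Y = 2(w − w₀)/θ`, `X = −w₀ Y`, `(X³ − 1)θ³ = N`
  set Y := 2 * (w - (w₀ : AlgebraicClosure ℚ)) / θ with hYdef
  have hY : Y * θ = 2 * (w - w₀) := div_mul_cancel₀ _ hθ0
  have hX3 : ((-(w₀ : AlgebraicClosure ℚ) * Y) ^ 3 - 1) * θ ^ 3 =
      -8 * w₀ * (w - w₀) ^ 3 - 3 * ((3 : AlgebraicClosure ℚ) ^ k * w + 8) := by
    linear_combination (-(w₀ : AlgebraicClosure ℚ) ^ 3 * (Y ^ 2 * θ ^ 2 + 2 * Y * θ * (w - w₀) +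
        4 * (w - w₀) ^ 2)) * hY + (-8 * (w₀ : AlgebraicClosure ℚ) * (w - w₀) ^ 3) * hsq + (-1 : AlgebraicClosure ℚ) * hθ
  have hvθ3 : v θ ^ 3 = t := by rw [← map_pow, hθ, map_mul, h8, mul_one]
  have hX3v : v ((-(w₀ : AlgebraicClosure ℚ) * Y) ^ 3 - 1) = s := by
    have h := congrArg v hX3
    rw [map_mul, map_pow, hvθ3, hN] at h
    -- `h : A * t = t * s`
    rw [mul_comm] at h
    exact mul_left_cancel₀ ht0 h
  have hXcube : v ((-(w₀ : AlgebraicClosure ℚ) * Y) ^ 3 - 1) ^ 3 = t := by rw [hX3v, hsdef, hs]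
  have hX1 := valuation_sub_one_pow_nine_of_cube hXcube
  -- `Y² − 1 = (X − 1)(X + 1)` with `X + 1` a unit
  have hfac : Y ^ 2 - 1 = (-(w₀ : AlgebraicClosure ℚ) * Y - 1) * (-(w₀ : AlgebraicClosure ℚ) * Y + 1) := by
    linear_combination (-Y ^ 2) * hsq
  have hXlt : v (-(w₀ : AlgebraicClosure ℚ) * Y - 1) < 1 := by
    by_contra hge
    rw [not_lt] at hge
    have : (1 : _) ≤ v (-(w₀ : AlgebraicClosure ℚ) * Y - 1) ^ 9 := one_le_pow₀ hge
    rw [hX1] at this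
    exact absurd ht1 (not_lt.mpr this)
  have hunit : v (-(w₀ : AlgebraicClosure ℚ) * Y + 1) = 1 := by
    have e : -(w₀ : AlgebraicClosure ℚ) * Y + 1 = 2 + (-(w₀ : AlgebraicClosure ℚ) * Y - 1) := by ring
    have h2 : v (2 : AlgebraicClosure ℚ) = 1 := by
      simpa using valuation_intCast_eq_one_of_not_dvd (n := 2) (by decide)
    rw [e, Valuation.map_add_eq_of_lt_left _ (by rw [h2]; exact hXlt), h2]
  -- rewrite the goal in terms of `Y`
  have hwθ : (θ ^ 3 - 24) / 3 ^ (k + 1) = w := by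
    rw [hθ, pow_succ]; field_simp; ring
  rw [hwθ]
  change v (Y ^ 2 - 1) ^ 9 = t
  rw [hfac, map_mul, hunit, mul_one, hX1]

end Summit.BirchSwinnertonDyer.Rank1Residual.GaloisImage
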